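import Summits.AtomisticToContinuum.Crystallization.Theorems.FreeSplittingCertificatesStrictSplittingRuleP1ReadSummable

/-!
# `StrictSplittingRule` (stmt-AtomisticToContinuum-12560): the READOUT-FORM DEMAND of H12⋆ in the language of the P1 bookkeeping — from `‖u_{q+s} − u_q − W(y_{q+s} − y_q)‖²` to leg loads of the far-ledger field (P1 interpolant object, part 42)

Route `FreeSplittingCertificates`, crux r3 `StrictSplittingRule` (H12⋆ = `stub_coreJointCoercive`), unit b2b-freesplit-B gen 32.
VALUE = the bridge between the LITERAL nonlocal readout-form term of `CoreJointSiteIneq` (Euclidean vectors `u : ℤ³ → ℝ³`, a linear co-rotation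
`W`, the first-order table `β` of `CoreJointCoercive`) and the leg-load form that parts 37–40 distribute over the cells (HOME CERT §27–§31):
* **`exists_p1Matrix`** — every linear `W : ℝ³ →ₗ ℝ³` acts by a matrix `A` in the `p1Disp` convention, `(W y)_k = Σ_j y_j A j k` (no new definition:
  the matrix is supplied as a hypothesis `hA` below, discharged by this lemma);
* **`norm_sq_coreReadout_eq_fpSq`** — `‖u(q+s) − u q − W(y_{q+s} − y_q)‖² = |V(q+s) − V q|²` for the far-ledger lattice field
  `V = p1DispSite a h u b₀ A` (any `b₀`; `A` the matrix of `W`): the co-rotated relative displacement IS a bond readout of the field of parts 30–41;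
* **`coreJoint_readoutForm_le_tsum_legLoad`** — for `β` with the decay of `CoreJointCoercive`, a finitely supported `u`, any site `p` and any linear `W`:
  the nonlocal readout-form demand `Σ'_{q≠p} Σ_{s∈Y₁} β(b_q)(p−q)(s)·½‖u(q+s) − u q − W(y_{q+s}−y_q)‖²` is summable and bounded by the leg-load series
  `Σ'_{(q,s)} [s∈Y₁]·(|β(b_q)(p−q)(s)|/2)·|V(q+s) − V q|²` (`V = p1DispSite a h u 0 A`), itself summable — the left side of `tsum_readout_leg_table_le_p1DispSite` (part 40) for the
  in-layer legs and of `tsum_readout_route_le_legs_p1DispSite` for the routed vertical bond.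
NOT a proof of H12⋆, NOT summit progress.  [folklore]
-/

noncomputable section

open Set Function
open scoped BigOperators

namespace Summit.AtomisticToContinuum.Crystallization.Theorems.StrictSplittingRuleBirth

open Literature.MathematicalPhysics.StatisticalMechanics
open Summit.AtomisticToContinuum.Crystallization.Theorems.PalmUnimodularRigidity.LayeredLawsSelectHcp

/-! ## A linear map as a matrix in the `p1Disp` convention -/

/-- **Every linear map `W : ℝ³ →ₗ ℝ³` acts by a matrix** in the `p1Disp` convention: with `A j k = (W e_j)_k`, `(W y)_k = Σ_j y_j·A j k`. -/
theorem exists_p1Matrix (W : EuclideanSpace ℝ (Fin 3) →ₗ[ℝ] EuclideanSpace ℝ (Fin 3)) :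
    ∃ A : Fin 3 → Fin 3 → ℝ, ∀ (y : EuclideanSpace ℝ (Fin 3)) (k : Fin 3), W y k = y 0 * A 0 k + y 1 * A 1 k + y 2 * A 2 k := by
  refine ⟨fun j k => W (WithLp.toLp 2 (fpE j)) k, fun y k => ?_⟩
  have hy : y = y 0 • WithLp.toLp 2 (fpE 0) + y 1 • WithLp.toLp 2 (fpE 1) + y 2 • WithLp.toLp 2 (fpE 2) := by
    ext i
    fin_cases i <;> simp [fpE]
  conv_lhs => rw [hy]
  simp only [map_add, map_smul, PiLp.add_apply, PiLp.smul_apply, smul_eq_mul]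

/-! ## The co-rotated relative displacement is a bond readout of the far-ledger field -/

/-- **`‖u(q+s) − u q − W(y_{q+s} − y_q)‖² = |V(q+s) − V q|²`** for `V = p1DispSite a h u b₀ A`, `A` the matrix of `W` (any `b₀`).
NOT a proof of H12⋆, NOT summit progress. -/
theorem norm_sq_coreReadout_eq_fpSq {a h : ℝ} (ha : a ≠ 0) (hh : h ≠ 0) (u : ℤ × ℤ × ℤ → EuclideanSpace ℝ (Fin 3))
    (W : EuclideanSpace ℝ (Fin 3) →ₗ[ℝ] EuclideanSpace ℝ (Fin 3)) (A : Fin 3 → Fin 3 → ℝ)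
    (hA : ∀ (y : EuclideanSpace ℝ (Fin 3)) (k : Fin 3), W y k = y 0 * A 0 k + y 1 * A 1 k + y 2 * A 2 k)
    (b₀ : Fin 3 → ℝ) (q s : ℤ × ℤ × ℤ) :
    ‖u (q + s) - u q - W (hcpSite a h (q + s) - hcpSite a h q)‖ ^ 2 =
      fpSq (fun k => p1DispSite a h (fun n k => u n k) b₀ A (q + s) k - p1DispSite a h (fun n k => u n k) b₀ A q k) := by
  have hc : ∀ k, (u (q + s) - u q - W (hcpSite a h (q + s) - hcpSite a h q)) k =
      p1DispSite a h (fun n k => u n k) b₀ A (q + s) k - p1DispSite a h (fun n k => u n k) b₀ A q k := by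
    intro k
    rw [p1DispSite_apply ha hh, p1DispSite_apply ha hh, PiLp.sub_apply, PiLp.sub_apply, hA,
      PiLp.sub_apply, PiLp.sub_apply, PiLp.sub_apply]
    ring
  rw [EuclideanSpace.norm_sq_eq, Fin.sum_univ_three, fpSq]
  simp only [Real.norm_eq_abs, sq_abs, hc]

/-! ## The readout-form demand is dominated by the leg-load series -/

/-- **THE NONLOCAL READOUT-FORM DEMAND OF H12⋆ IS A LEG-LOAD SERIES OF THE FAR-LEDGER FIELD.**  For a first-order table `β` with the decay of
`CoreJointCoercive` (`|β(b_p)(q−p)(s)| ≤ C(1+‖y_q − y_p‖)⁻⁶`), a finite stencil `Y₁`, a finitely supported displacement `u`, any site `p` and any linear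
`W` acting by the matrix `A`, with `V = p1DispSite a h u 0 A` and the weights `w(q,s) = [s ∈ Y₁]·|β(b_q)(p−q)(s)|/2`:
the readout-form family `q ↦ [q ≠ p]·Σ_{s∈Y₁} β(b_q)(p−q)(s)·½‖u(q+s) − u q − W(y_{q+s} − y_q)‖²` is summable, the leg-load family
`(q,s) ↦ w(q,s)·|V(q+s) − V q|²` is summable, and the sum of the first is at most the sum of the second.
NOT a proof of H12⋆, NOT summit progress. -/
theorem coreJoint_readoutForm_le_tsum_legLoad {a h C : ℝ} (ha : 0 < a) (hh : 0 < h) (Y₁ : Finset (ℤ × ℤ × ℤ))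
    (β : Bool → (ℤ × ℤ × ℤ) → (ℤ × ℤ × ℤ) → ℝ)
    (hβ : ∀ p q : ℤ × ℤ × ℤ, ∀ s, |β (decide (Even p.1)) (q - p) s| ≤ C * ((1 + ‖hcpSite a h q - hcpSite a h p‖)⁻¹) ^ 6)
    (u : ℤ × ℤ × ℤ → EuclideanSpace ℝ (Fin 3)) (hu : (support u).Finite) (p : ℤ × ℤ × ℤ)
    (W : EuclideanSpace ℝ (Fin 3) →ₗ[ℝ] EuclideanSpace ℝ (Fin 3)) (A : Fin 3 → Fin 3 → ℝ)
    (hA : ∀ (y : EuclideanSpace ℝ (Fin 3)) (k : Fin 3), W y k = y 0 * A 0 k + y 1 * A 1 k + y 2 * A 2 k) :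
    Summable (fun q : ℤ × ℤ × ℤ => if q = p then (0 : ℝ) else
      ∑ s ∈ Y₁, β (decide (Even q.1)) (p - q) s * (1 / 2 * ‖u (q + s) - u q - W (hcpSite a h (q + s) - hcpSite a h q)‖ ^ 2)) ∧
    Summable (fun e : (ℤ × ℤ × ℤ) × (ℤ × ℤ × ℤ) =>
      (if e.2 ∈ Y₁ then |β (decide (Even e.1.1)) (p - e.1) e.2| / 2 else 0) *
        fpSq (fun k => p1DispSite a h (fun n k => u n k) 0 A (e.1 + e.2) k -
          p1DispSite a h (fun n k => u n k) 0 A e.1 k)) ∧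
    (∑' q : ℤ × ℤ × ℤ, if q = p then (0 : ℝ) else
      ∑ s ∈ Y₁, β (decide (Even q.1)) (p - q) s * (1 / 2 * ‖u (q + s) - u q - W (hcpSite a h (q + s) - hcpSite a h q)‖ ^ 2)) ≤
    ∑' e : (ℤ × ℤ × ℤ) × (ℤ × ℤ × ℤ),
      (if e.2 ∈ Y₁ then |β (decide (Even e.1.1)) (p - e.1) e.2| / 2 else 0) *
        fpSq (fun k => p1DispSite a h (fun n k => u n k) 0 A (e.1 + e.2) k -
          p1DispSite a h (fun n k => u n k) 0 A e.1 k) := by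
  have ha' := ha.ne'
  have hh' := hh.ne'
  -- the coordinate field is finitely supported
  have hU : (support fun n => fun k => u n k).Finite := by
    refine hu.subset fun n hn => ?_
    simp only [mem_support, ne_eq] at hn ⊢
    intro h0
    apply hn
    funext k
    rw [h0]
    rfl
  set V : ℤ × ℤ × ℤ → (Fin 3 → ℝ) := fun n k => p1DispSite a h (fun n k => u n k) 0 A n k with hVdef
  -- readout of V along (q, s)
  set R : (ℤ × ℤ × ℤ) → (ℤ × ℤ × ℤ) → ℝ := fun q s => fpSq (fun k => V (q + s) k - V q k) with hRdef
  have hR0 : ∀ q s, 0 ≤ R q s := fun q s => fpSq_nonneg _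
  have hnorm : ∀ q s, ‖u (q + s) - u q - W (hcpSite a h (q + s) - hcpSite a h q)‖ ^ 2 = R q s := fun q s =>
    norm_sq_coreReadout_eq_fpSq ha' hh' u W A hA 0 q s
  -- bounded readouts per offset
  have hb : ∀ s : ℤ × ℤ × ℤ, ∃ B : ℝ, ∀ q, R q s ≤ B := fun s => exists_bound_readout_p1DispSite ha hh _ hU 0 A s
  choose Bf hBf using hb
  -- the row sums g q = Σ_{s∈Y₁} |β|/2 · R q s
  set g : (ℤ × ℤ × ℤ) → ℝ := fun q => ∑ s ∈ Y₁, |β (decide (Even q.1)) (p - q) s| / 2 * R q s with hgdef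
  have hg0 : ∀ q, 0 ≤ g q := fun q => Finset.sum_nonneg fun s _ => mul_nonneg (by positivity) (hR0 q s)
  have hgs : Summable g := by
    refine summable_sum fun s _ => ?_
    refine summableTransfer_summable_of_abs_le ha hh p (C := C / 2 * Bf s) fun q => ?_
    have hd := hβ q p s
    rw [norm_sub_rev] at hd
    rw [abs_mul, abs_of_nonneg (hR0 q s), abs_div, abs_abs, abs_two]
    have hC0 : 0 ≤ C * ((1 + ‖hcpSite a h q - hcpSite a h p‖)⁻¹) ^ 6 := (abs_nonneg _).trans hd
    calc |β (decide (Even q.1)) (p - q) s| / 2 * R q s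
        ≤ C * ((1 + ‖hcpSite a h q - hcpSite a h p‖)⁻¹) ^ 6 / 2 * Bf s :=
          mul_le_mul (div_le_div_of_nonneg_right hd zero_le_two) (hBf s q) (hR0 q s) (by positivity)
      _ = C / 2 * Bf s * ((1 + ‖hcpSite a h q - hcpSite a h p‖)⁻¹) ^ 6 := by ring
  -- (1) the readout-form family is dominated by g
  have hdom : ∀ q, |(if q = p then (0 : ℝ) else
      ∑ s ∈ Y₁, β (decide (Even q.1)) (p - q) s * (1 / 2 * ‖u (q + s) - u q - W (hcpSite a h (q + s) - hcpSite a h q)‖ ^ 2))| ≤ g q := by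
    intro q
    split_ifs with hq
    · rw [abs_zero]; exact hg0 q
    · refine (Finset.abs_sum_le_sum_abs _ _).trans (Finset.sum_le_sum fun s _ => ?_)
      rw [hnorm q s, abs_mul, abs_of_nonneg (by linarith [hR0 q s] : (0 : ℝ) ≤ 1 / 2 * R q s)]
      exact le_of_eq (by ring)
  have hS1 : Summable (fun q : ℤ × ℤ × ℤ => if q = p then (0 : ℝ) else
      ∑ s ∈ Y₁, β (decide (Even q.1)) (p - q) s * (1 / 2 * ‖u (q + s) - u q - W (hcpSite a h (q + s) - hcpSite a h q)‖ ^ 2)) :=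
    Summable.of_norm_bounded hgs fun q => by rw [Real.norm_eq_abs]; exact hdom q
  -- (2) the leg-load family on the product: rows supported in Y₁, row sums = g
  have hF0 : ∀ e : (ℤ × ℤ × ℤ) × (ℤ × ℤ × ℤ),
      0 ≤ (if e.2 ∈ Y₁ then |β (decide (Even e.1.1)) (p - e.1) e.2| / 2 else 0) * R e.1 e.2 := fun e =>
    mul_nonneg (by split_ifs <;> positivity) (hR0 _ _)
  have hrow : ∀ q : ℤ × ℤ × ℤ, Summable fun s : ℤ × ℤ × ℤ =>
      (if s ∈ Y₁ then |β (decide (Even q.1)) (p - q) s| / 2 else 0) * R q s := fun q =>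
    summable_of_ne_finset_zero (s := Y₁) fun s hs => by rw [if_neg hs, zero_mul]
  have hrow_eq : ∀ q : ℤ × ℤ × ℤ, ∑' s : ℤ × ℤ × ℤ,
      (if s ∈ Y₁ then |β (decide (Even q.1)) (p - q) s| / 2 else 0) * R q s = g q := by
    intro q
    rw [tsum_eq_sum (s := Y₁) fun s hs => by rw [if_neg hs, zero_mul]]
    exact Finset.sum_congr rfl fun s hs => by rw [if_pos hs]
  have hS2 : Summable (fun e : (ℤ × ℤ × ℤ) × (ℤ × ℤ × ℤ) =>
      (if e.2 ∈ Y₁ then |β (decide (Even e.1.1)) (p - e.1) e.2| / 2 else 0) * R e.1 e.2) :=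
    (summable_prod_of_nonneg hF0).2 ⟨hrow, hgs.congr fun q => (hrow_eq q).symm⟩
  refine ⟨hS1, hS2, ?_⟩
  -- (3) compare the sums
  calc ∑' q : ℤ × ℤ × ℤ, (if q = p then (0 : ℝ) else
        ∑ s ∈ Y₁, β (decide (Even q.1)) (p - q) s * (1 / 2 * ‖u (q + s) - u q - W (hcpSite a h (q + s) - hcpSite a h q)‖ ^ 2))
      ≤ ∑' q, g q := Summable.tsum_le_tsum (fun q => (le_abs_self _).trans (hdom q)) hS1 hgs
    _ = ∑' q, ∑' s : ℤ × ℤ × ℤ, (if s ∈ Y₁ then |β (decide (Even q.1)) (p - q) s| / 2 else 0) * R q s :=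
        tsum_congr fun q => (hrow_eq q).symm
    _ = ∑' e : (ℤ × ℤ × ℤ) × (ℤ × ℤ × ℤ), (if e.2 ∈ Y₁ then |β (decide (Even e.1.1)) (p - e.1) e.2| / 2 else 0) * R e.1 e.2 :=
        (hS2.tsum_prod).symm

end Summit.AtomisticToContinuum.Crystallization.Theorems.StrictSplittingRuleBirth

end
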